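import Summits.AnomalousDissipation.AnomalousDissipation.Theorems.SolenoidalFractalHomogenisationLagrangianStepWindowDuality
import Summits.AnomalousDissipation.AnomalousDissipation.Theorems.SolenoidalFractalHomogenisationLagrangianStepWindowPropagatorL
import Summits.AnomalousDissipation.AnomalousDissipation.Theorems.SolenoidalFractalHomogenisationLagrangianStepTwoProblemCross
import Summits.AnomalousDissipation.AnomalousDissipation.Theorems.SolenoidalFractalHomogenisationLagrangianCarrierConstructionRegularLConjugation
import HarnessLib

/-!
# K1L_D (stmt-AnomalousDissipation-27980), line «onelevel-design»: the window-error duality (Z1 of memo L7) READ ON THE CARRIER —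
# the cross density of the §9 pair `(Um, Um1)` (helper; `--supports … --as helper`; lead-k1l-onelevel-p1 g4)

`…LagrangianStepWindowDuality` (p679212) gives, for two abstract `Torus.IsPropagator` families, `⟪U₁ s t x, y⟫ − ⟪U₂ s t x, y⟫ = ∫ cross density`.
THIS FILE instantiates it at the pair of the registered §9 texts of `stub_cellInputs` (split v31 §9z): the TRUE window propagator `Um1`
(carrier `E.partialSum (m+1)`, tensor `kbar (m+1) • S`) and the COARSE one `Um` (carrier `E.partialSum m`, tensor
`kbar m • renormStep Φ g S`) of a regular Lagrangian lattice carrier `E`, for shapes `S, Φ S` in a window `NearIso · lo hi`, `g ≥ 0`: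

* `partialSum_succ_sub_coord` — the carrier difference IS the fine level: `b_{≤m+1} − b_{≤m} = E.b (m+1)`;
* `nearIso_renormStep'`, `nearIso_pair` — both tensors lie in the common window `[min(kbar_m, kbar_{m+1})·lo, max(kbar_m, kbar_{m+1})·hi]`;
* `kbar_smul_renormStep_eq` — under the Taylor recursion `kbar m = kbar (m+1)·(1 + g)` the tensor difference is MINUS THE EDDY TENSOR:
  `kbar (m+1) • S − kbar m • renormStep Φ g S = −((kbar (m+1) · g) • Φ S)`;
* **`inner_sub_eq_setIntegral_cross_level`** — for `0 ≤ s < t ≤ 1`, divergence-free `x, y ∈ V2`, EVERY true solution `w` restarted at `s`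
  from `x` and EVERY coarse adjoint solution `ψ` from `y` at `t`:
  `⟪Um1 s t x, y⟫ − ⟪Um s t x, y⟫ = ∫_{(0,t−s]} Σ'ₖ Re( −4π² ⟪ŵ(σ)(k), T_{kbar(m+1)•S − kbar m•R}(k) ψ̂(t−s−σ)(k)⟫ + Σⱼ 2πikⱼ ⟪𝓕((E.b (m+1) (s+σ))ⱼ w(σ))(k), ψ̂(t−s−σ)(k)⟫ ) dσ`
  — the integrand that the one-window homogenisation estimate (§9z (BIL); memo L7 bricks Z3/Z4) must bound: the FLUX of the fine level on
  the true solution against the coarse adjoint field, minus the EDDY-VISCOUS pairing.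
NOT a proof of §9z, of the crux, or of AD; rung F-D1.A0.
-/

set_option linter.dupNamespace false  -- the summit-side namespace `Summit.AnomalousDissipation.AnomalousDissipation.…` repeats a component by design (D-0017)

noncomputable section

namespace Summit.AnomalousDissipation.AnomalousDissipation.Theorems.SolenoidalFractalHomogenisation.LagrangianStep.WindowDuality

open Literature.Analysis Literature.Analysis.FluidPDE Literature.Analysis.FluidPDE.Torus Literature.Analysis.FunctionSpaces
open MeasureTheory Set Filter Complex UnitAddTorus Function
open scoped ENNReal NNReal InnerProductSpace
open Literature.Analysis.FluidPDE.LatticeShear (LagrangianLatticeCarrier)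
open Summit.AnomalousDissipation.AnomalousDissipation.Theorems.SolenoidalFractalHomogenisation.LagrangianRenormalisationStep
  (memLp_top_stLift_of_continuous continuous_uncurry_partialSum isWeaklyDivFree_partialSum)

variable {k : ℕ}

/-! ## The carrier difference is the fine level -/

/-- Coordinatewise: `(b_{≤m+1})ⱼ − (b_{≤m})ⱼ = (b_{m+1})ⱼ` (from `LagrangianCarrierConstruction.partialSum_succ_apply`). -/
theorem partialSum_succ_sub_coord (E : LagrangianLatticeCarrier k) (m : ℕ) (t : ℝ) (z : UnitAddTorus (Fin 3)) (j : Fin 3) :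
    E.partialSum (m + 1) t z j - E.partialSum m t z j = E.b (m + 1) t z j := by
  rw [LagrangianCarrierConstruction.partialSum_succ_apply, PiLp.add_apply]; ring

/-! ## The two window tensors share a Legendre–Hadamard window -/

/-- `renormStep Φ g S` is in the window of `S` and `Φ S` (convex combination, `g ≥ 0`). -/
theorem nearIso_renormStep' {Φ : FluidPDE.Torus.Visc4 (Fin 3) → FluidPDE.Torus.Visc4 (Fin 3)} {S : FluidPDE.Torus.Visc4 (Fin 3)}
    {lo hi g : ℝ} (hSn : FluidPDE.Torus.NearIso S lo hi) (hΦSn : FluidPDE.Torus.NearIso (Φ S) lo hi) (hg : 0 ≤ g) :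
    FluidPDE.Torus.NearIso (renormStep Φ g S) lo hi := by
  have hg1 : (0:ℝ) ≤ 1 / (1 + g) := by positivity
  have h := (hSn.add (hΦSn.smul hg)).smul hg1
  refine nearIso_congr h ?_ ?_ <;> field_simp

/-- The common window of the pair: `kbar (m+1) • S` and `kbar m • renormStep Φ g S` are both
`NearIso (min (kbar m) (kbar (m+1)) · lo) (max (kbar m) (kbar (m+1)) · hi)` (`0 ≤ lo`). -/
theorem nearIso_pair (E : LagrangianLatticeCarrier k) (m : ℕ) {Φ : FluidPDE.Torus.Visc4 (Fin 3) → FluidPDE.Torus.Visc4 (Fin 3)}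
    {S : FluidPDE.Torus.Visc4 (Fin 3)} {lo hi g : ℝ} (hlo : 0 ≤ lo) (hSn : FluidPDE.Torus.NearIso S lo hi)
    (hΦSn : FluidPDE.Torus.NearIso (Φ S) lo hi) (hg : 0 ≤ g) :
    FluidPDE.Torus.NearIso (E.kbar (m + 1) • S) (min (E.kbar m) (E.kbar (m + 1)) * lo) (max (E.kbar m) (E.kbar (m + 1)) * hi) ∧
      FluidPDE.Torus.NearIso (E.kbar m • renormStep Φ g S) (min (E.kbar m) (E.kbar (m + 1)) * lo)
        (max (E.kbar m) (E.kbar (m + 1)) * hi) := by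
  have hk0 := (E.kbar_pos m).le
  have hk1 := (E.kbar_pos (m + 1)).le
  have hhi : 0 ≤ hi := by
    -- `lo ≤ hi` is forced by the window at any transverse pair; we only need `0 ≤ hi`, read off at `k = e₀`, `p = e₁`
    have h := hSn (fun a => if a = 0 then 1 else 0) (fun i => if i = 1 then 1 else 0) (by simp)
    have h2 : lo * ((∑ a : Fin 3, (if a = 0 then (1:ℝ) else 0) ^ 2) * ∑ i : Fin 3, (if i = 1 then (1:ℝ) else 0) ^ 2) ≤
        hi * ((∑ a : Fin 3, (if a = 0 then (1:ℝ) else 0) ^ 2) * ∑ i : Fin 3, (if i = 1 then (1:ℝ) else 0) ^ 2) := h.1.trans h.2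
    simp at h2
    linarith
  refine ⟨(hSn.smul hk1).mono ?_ ?_, ((nearIso_renormStep' hSn hΦSn hg).smul hk0).mono ?_ ?_⟩
  · exact mul_le_mul_of_nonneg_right (min_le_right _ _) hlo
  · exact mul_le_mul_of_nonneg_right (le_max_right _ _) hhi
  · exact mul_le_mul_of_nonneg_right (min_le_left _ _) hlo
  · exact mul_le_mul_of_nonneg_right (le_max_left _ _) hhi

/-- **Under the Taylor recursion the tensor difference is minus the eddy tensor**: `kbar m = kbar (m+1)·(1+g)` gives
`kbar (m+1) • S − kbar m • renormStep Φ g S = −((kbar (m+1) · g) • Φ S)`. -/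
theorem kbar_smul_renormStep_eq {Φ : FluidPDE.Torus.Visc4 (Fin 3) → FluidPDE.Torus.Visc4 (Fin 3)} {S : FluidPDE.Torus.Visc4 (Fin 3)}
    {κ κ' g : ℝ} (hg : 0 ≤ g) (hκ : κ = κ' * (1 + g)) :
    κ' • S - κ • renormStep Φ g S = -((κ' * g) • Φ S) := by
  have hne : (1 + g) ≠ 0 := by positivity
  rw [hκ, renormStep, smul_smul, show κ' * (1 + g) * (1 / (1 + g)) = κ' by field_simp, smul_add, smul_smul]
  abel

/-! ## The window-error duality identity of the §9 pair -/

/-- **Z1 read on the carrier.**  See the module docstring: for a regular Lagrangian lattice carrier `E`, level `m`, shapes `S, Φ S` in a window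
`NearIso · lo hi` (`lo > 0`), `g ≥ 0`, the TRUE propagator `Um1` (carrier `E.partialSum (m+1)`, tensor `kbar (m+1) • S`) and the COARSE one
`Um` (carrier `E.partialSum m`, tensor `kbar m • renormStep Φ g S`) on `[0,1]`, `0 ≤ s < t ≤ 1`, divergence-free `x, y ∈ V2`, every true weak
solution `w` on `[s,1)` from `x` and every coarse adjoint solution `ψ` on `[0,t−s)` from `y`:
`⟪Um1 s t x, y⟫ − ⟪Um s t x, y⟫ = ∫_{(0,t−s]} Σ'ₖ Re( −4π² ⟪ŵ(σ)(k), T_{kbar(m+1)•S − kbar m•renormStep Φ g S}(k) ψ̂(t−s−σ)(k)⟫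
  + Σⱼ 2πikⱼ ⟪𝓕((E.b (m+1) (s+σ) ·)ⱼ • w σ)(k), ψ̂(t−s−σ)(k)⟫ ) dσ`. -/
theorem inner_sub_eq_setIntegral_cross_level (E : LagrangianLatticeCarrier k) (hR : E.Regular) (m : ℕ)
    {Φ : FluidPDE.Torus.Visc4 (Fin 3) → FluidPDE.Torus.Visc4 (Fin 3)} {S : FluidPDE.Torus.Visc4 (Fin 3)} {lo hi : ℝ} (hlo : 0 < lo)
    (hSn : FluidPDE.Torus.NearIso S lo hi) (hΦSn : FluidPDE.Torus.NearIso (Φ S) lo hi) {g : ℝ} (hg : 0 ≤ g)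
    {Um Um1 : ℝ → ℝ → (V2 →L[ℝ] V2)}
    (hUm : FluidPDE.Torus.IsPropagator 1 (E.partialSum m) (E.kbar m • renormStep Φ g S) Um)
    (hUm1 : FluidPDE.Torus.IsPropagator 1 (E.partialSum (m + 1)) (E.kbar (m + 1) • S) Um1)
    {s t : ℝ} (hs : 0 ≤ s) (hst : s < t) (ht1 : t ≤ 1) (x y : V2)
    (hxdiv : FunctionSpaces.Torus.IsWeaklyDivFree (x : VF)) (hydiv : FunctionSpaces.Torus.IsWeaklyDivFree (y : VF))
    {w : ℝ → VF}
    (hw : FluidPDE.Torus.IsWeakTensorPassiveVectorOn 0 (1 - s) (E.kbar (m + 1) • S) (fun τ => E.partialSum (m + 1) (s + τ)) (x : VF) w)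
    {ψ : ℝ → VF}
    (hψ : FluidPDE.Torus.IsWeakTensorPassiveVectorOn 0 (t - s) (FluidPDE.Torus.majorTranspose (E.kbar m • renormStep Φ g S))
      (fun r => -E.partialSum m (t - r)) (y : VF) ψ) :
    ⟪Um1 s t x, y⟫_ℝ - ⟪Um s t x, y⟫_ℝ =
      ∫ σ in Ioc 0 (t - s), ∑' k' : Fin 3 → ℤ,
        ((-(4 * Real.pi ^ 2 : ℝ) : ℂ) *
            ⟪mFourierCoeff (EuclideanSpace.complexify ∘ w σ) k',
              symbT (E.kbar (m + 1) • S - E.kbar m • renormStep Φ g S) k'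
                (mFourierCoeff (EuclideanSpace.complexify ∘ ψ (t - s - σ)) k')⟫_ℂ +
          ∑ j, (2 * Real.pi * I * (k' j)) *
            ⟪mFourierCoeff (EuclideanSpace.complexify ∘ fun z => E.b (m + 1) (s + σ) z j • w σ z) k',
              mFourierCoeff (EuclideanSpace.complexify ∘ ψ (t - s - σ)) k'⟫_ℂ).re := by
  -- carrier regularity from `E.Regular`
  have hc : ∀ n, ∀ i < n, Continuous (uncurry (E.b (i + 1))) := fun n i _ => hR.levelRegular.continuous_uncurry_b i
  have hd : ∀ n, ∀ i < n, ∀ t, FunctionSpaces.Torus.IsWeaklyDivFree (E.b (i + 1) t) :=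
    fun n i _ t => hR.levelRegular.isWeaklyDivFree_b i t
  have hb₁ : MemLp (FunctionSpaces.Torus.stLift (E.partialSum (m + 1))) ∞
      (volume.restrict (Ioo 0 1 ×ˢ (univ : Set (EuclideanSpace ℝ (Fin 3))))) :=
    memLp_top_stLift_of_continuous (continuous_uncurry_partialSum E (m + 1) (hc (m + 1))) 1
  have hb₂ : MemLp (FunctionSpaces.Torus.stLift (E.partialSum m)) ∞
      (volume.restrict (Ioo 0 1 ×ˢ (univ : Set (EuclideanSpace ℝ (Fin 3))))) :=
    memLp_top_stLift_of_continuous (continuous_uncurry_partialSum E m (hc m)) 1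
  have hb₂div : ∀ᵐ τ ∂(volume.restrict (Ioo (0 : ℝ) 1)), FunctionSpaces.Torus.IsWeaklyDivFree (E.partialSum m τ) :=
    ae_of_all _ fun τ => isWeaklyDivFree_partialSum E m (hc m) (hd m) τ
  -- the common window
  obtain ⟨h𝔸₁, h𝔸₂⟩ := nearIso_pair E m hlo.le hSn hΦSn hg
  have hlo' : 0 < min (E.kbar m) (E.kbar (m + 1)) * lo := mul_pos (lt_min (E.kbar_pos m) (E.kbar_pos (m + 1))) hlo
  -- Z1 at the propagator level
  have key := inner_sub_eq_setIntegral_crossDensity' hUm1 hUm h𝔸₁ h𝔸₂ hlo' hb₁ hb₂ hb₂div hs hst ht1 x y hxdiv hydiv hw hψ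
  rw [key]
  simp_rw [← symbT_sub_tensor, partialSum_succ_sub_coord]

/-- **The same identity with the eddy tensor**: under the Taylor recursion `kbar m = kbar (m+1)·(1+g)` the viscous cross term is
`+4π² ⟪ŵ(σ)(k), T_{(kbar(m+1)·g)•Φ S}(k) ψ̂⟫` (the fine level is SUPPOSED to generate exactly this eddy pairing; (BIL) says it does, window by
window, up to `ηz`). -/
theorem inner_sub_eq_setIntegral_cross_level_eddy (E : LagrangianLatticeCarrier k) (hR : E.Regular) (m : ℕ)
    {Φ : FluidPDE.Torus.Visc4 (Fin 3) → FluidPDE.Torus.Visc4 (Fin 3)} {S : FluidPDE.Torus.Visc4 (Fin 3)} {lo hi : ℝ} (hlo : 0 < lo)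
    (hSn : FluidPDE.Torus.NearIso S lo hi) (hΦSn : FluidPDE.Torus.NearIso (Φ S) lo hi) {g : ℝ} (hg : 0 ≤ g)
    (htaylor : E.kbar m = E.kbar (m + 1) * (1 + g))
    {Um Um1 : ℝ → ℝ → (V2 →L[ℝ] V2)}
    (hUm : FluidPDE.Torus.IsPropagator 1 (E.partialSum m) (E.kbar m • renormStep Φ g S) Um)
    (hUm1 : FluidPDE.Torus.IsPropagator 1 (E.partialSum (m + 1)) (E.kbar (m + 1) • S) Um1)
    {s t : ℝ} (hs : 0 ≤ s) (hst : s < t) (ht1 : t ≤ 1) (x y : V2)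
    (hxdiv : FunctionSpaces.Torus.IsWeaklyDivFree (x : VF)) (hydiv : FunctionSpaces.Torus.IsWeaklyDivFree (y : VF))
    {w : ℝ → VF}
    (hw : FluidPDE.Torus.IsWeakTensorPassiveVectorOn 0 (1 - s) (E.kbar (m + 1) • S) (fun τ => E.partialSum (m + 1) (s + τ)) (x : VF) w)
    {ψ : ℝ → VF}
    (hψ : FluidPDE.Torus.IsWeakTensorPassiveVectorOn 0 (t - s) (FluidPDE.Torus.majorTranspose (E.kbar m • renormStep Φ g S))
      (fun r => -E.partialSum m (t - r)) (y : VF) ψ) :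
    ⟪Um1 s t x, y⟫_ℝ - ⟪Um s t x, y⟫_ℝ =
      ∫ σ in Ioc 0 (t - s), ∑' k' : Fin 3 → ℤ,
        (((4 * Real.pi ^ 2 : ℝ) : ℂ) *
            ⟪mFourierCoeff (EuclideanSpace.complexify ∘ w σ) k',
              symbT ((E.kbar (m + 1) * g) • Φ S) k' (mFourierCoeff (EuclideanSpace.complexify ∘ ψ (t - s - σ)) k')⟫_ℂ +
          ∑ j, (2 * Real.pi * I * (k' j)) *
            ⟪mFourierCoeff (EuclideanSpace.complexify ∘ fun z => E.b (m + 1) (s + σ) z j • w σ z) k',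
              mFourierCoeff (EuclideanSpace.complexify ∘ ψ (t - s - σ)) k'⟫_ℂ).re := by
  rw [inner_sub_eq_setIntegral_cross_level E hR m hlo hSn hΦSn hg hUm hUm1 hs hst ht1 x y hxdiv hydiv hw hψ,
    kbar_smul_renormStep_eq hg htaylor]
  refine setIntegral_congr_fun measurableSet_Ioc fun σ _ => ?_
  refine tsum_congr fun k' => ?_
  congr 2
  rw [show -((E.kbar (m + 1) * g) • Φ S) = (-(E.kbar (m + 1) * g)) • Φ S by rw [neg_smul], symbT_smul_tensor, symbT_smul_tensor,
    inner_smul_right, inner_smul_right]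
  push_cast
  ring

end Summit.AnomalousDissipation.AnomalousDissipation.Theorems.SolenoidalFractalHomogenisation.LagrangianStep.WindowDuality

end
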